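import Mathlib
import Summits.ValiantsHypothesis.ValiantsHypothesis.Theorems.PerDivisionHard.Negative.PerSupportBound
import Summits.ValiantsHypothesis.ValiantsHypothesis.Theorems.DivisionGapPerMultiplesHardStubRichFaces
import Literature.Computability.AlgebraicComplexity.ArithCircuitProofs
import Literature.Computability.AlgebraicComplexity.PermanentIrreducible

/-!
# `DivisionGap.PerMultiplesHard` (stmt-ValiantsHypothesis-5068), line `uncharged-face-walk`:
Jerrum–Snir by SUB-support with the EXACT binomial (stub `stub_sharpSubSupportCount`)

For `m ≥ 3` and every `p` over `ℝ≥0` all of whose monomials are permutation monomials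
(`supp p ⊆ supp per_m`) there is a degree `d` in the window `m < 3d ≤ 2m` with

  `#supp p · C(m, d) ≤ L⁺(p) · m!`,

for the tree's monotone fan-in-two `complexity` `L⁺` over `ℝ≥0`.

Mechanism: the proof of `RichFaces.two_pow_mul_card_support_le`
(`Theorems/DivisionGapPerMultiplesHardStubRichFaces.lean`) stopped one step earlier — instead of
throwing the binomial away via `two_pow_le_choose_middle` (`2^{m/3} ≤ C(m, deg a_t)`), the window
degree `d` MINIMISING `C(m, ·)` on `(m/3, 2(m/3)]` is exposed:
1. `supp p ⊆ supp per_m` makes `p` homogeneous of degree `m`, so a fan-in-two circuit `P` for `p`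
   writes `p = Σ_t a_t b_t` with `≤ prodCount P` terms and `deg a_t ∈ (m/3, 2(m/3)]`
   (`exists_decomposition` with parameter `m/3 ≥ 1`).
2. No cancellation over `ℝ≥0`: `supp (a_t b_t) ⊆ supp p ⊆ supp per_m`, so the rectangle bound
   `card_support_mul_choose_le` gives `#supp (a_t b_t) · C(m, deg a_t) ≤ m!`, and
   `C(m, d) ≤ C(m, deg a_t)` by minimality (`Finset.exists_min_image` on the nonempty window
   `Finset.Ioc (m/3) (2*(m/3)) ∋ m/3 + 1`).
3. Summing, `#supp p · C(m,d) ≤ Σ_t #supp (a_t b_t) · C(m,d) ≤ prodCount P · m! ≤ L⁺(p) · m!` for a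
   minimal circuit (`exists_computes_size_eq_complexity`, `prodCount_le_size`).
4. Window arithmetic: `d ≥ m/3 + 1 ⇒ 3d > m`, `d ≤ 2(m/3) ⇒ 3d ≤ 2m` (`omega`).

Log (stub-worker): `card_support_mul_choose_le_prodCount_mul` is
`RichFaces.two_pow_mul_card_support_le` with `2^{m/3}` replaced by the minimal window binomial
`C(m,d)` (hypothesis `hmin`) and `m ≥ 6` relaxed to `m ≥ 3` (only `1 ≤ m/3` is used); the stub picks
`d` by `Finset.exists_min_image` and a minimal circuit. [cite: JerrumSnir1982, §4.3 and Cor. 3.5]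
-/

noncomputable section

open MvPolynomial Literature.Computability.AlgebraicComplexity
open scoped NNReal BigOperators
open Summit.ValiantsHypothesis.ValiantsHypothesis.Theorems.PerDivisionHard.Negative
open Literature.Barriers.ValiantsHypothesis

namespace Summit.ValiantsHypothesis.ValiantsHypothesis.Theorems.DivisionGap.PerMultiplesHard.SharpSubSupportCount

variable {m : ℕ}

/-! ### Jerrum–Snir by sub-support, keeping the window binomial -/

-- adapted from Theorems/DivisionGapPerMultiplesHardStubRichFaces.lean
-- (`RichFaces.two_pow_mul_card_support_le`, `2^{m/3}` replaced by the minimal window binomial)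
/-- **Jerrum–Snir by SUB-support with the exact binomial.**  If every monomial of `p` is a
permutation monomial (`supp p ⊆ supp per_m`, `m ≥ 3`), `P` is a fan-in-two circuit over `ℝ≥0`
computing `p`, and `C(m, d)` is minimal among the binomials `C(m, d')`, `d' ∈ (m/3, 2(m/3)]`, then
`#supp p · C(m, d) ≤ prodCount P · m!`: the balanced decomposition `p = Σ_t a_t b_t`
(`exists_decomposition`) has `deg a_t` in the window and `supp (a_t b_t) ⊆ supp per_m` (no
cancellation), hence `#supp (a_t b_t) · C(m, d) ≤ #supp (a_t b_t) · C(m, deg a_t) ≤ m!` by the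
rectangle bound; sum over `t`. [cite: JerrumSnir1982, §4.3 and Cor. 3.5] -/
theorem card_support_mul_choose_le_prodCount_mul (hm : 3 ≤ m)
    {p : MvPolynomial (Fin m × Fin m) ℝ≥0} (hp : p.support ⊆ (perPoly (Fin m) ℝ≥0).support)
    {P : ArithCircuit ℝ≥0 (Fin m × Fin m)} (hP2 : P.IsFanInTwo) (hP : P.Computes p) {d : ℕ}
    (hmin : ∀ d' ∈ Finset.Ioc (m / 3) (2 * (m / 3)), m.choose d ≤ m.choose d') :
    p.support.card * m.choose d ≤ prodCount P * m.factorial := by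
  classical
  have heval : P.eval = p := hP
  have hhom : p.IsHomogeneous m := by
    intro e he
    have he' : e ∈ (perPoly (Fin m) ℝ≥0).support := hp (mem_support_iff.mpr he)
    have := perPoly_isHomogeneous (n := Fin m) (k := ℝ≥0) (mem_support_iff.mp he')
    rwa [Fintype.card_fin] at this
  have hm1 : 1 ≤ m / 3 := by omega
  have hmN : m / 3 < m := by omega
  obtain ⟨L, hLlen, hLsum, hLdeg⟩ :=
    Literature.Barriers.ValiantsHypothesis.exists_decomposition hm1 hmN _ P le_rfl hP2
      (by rw [heval]; exact hhom)
  rw [heval] at hLsum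
  -- each product covers at most `m!/C(m,d)` monomials: `|mon(ab)| C(m,d) ≤ |mon(ab)| C(m,deg a) ≤ m!`
  have hterm : ∀ ab ∈ L, (ab.1 * ab.2).support.card * m.choose d ≤ m.factorial := by
    intro ab hab
    by_cases hb : ab.2 = 0
    · simp [hb]
    have hdeg := hLdeg ab hab
    have ha : ab.1 ≠ 0 := by
      intro ha
      rw [ha, totalDegree_zero] at hdeg
      omega
    have hsub : (ab.1 * ab.2).support ⊆ (perPoly (Fin m) ℝ≥0).support := by
      obtain ⟨q, hq⟩ := exists_sum_eq_add_of_mem (fun ab : MvPolynomial _ ℝ≥0 × _ => ab.1 * ab.2)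
        L ab hab
      exact (support_subset_of_eq_add (hLsum.trans hq)).trans hp
    obtain ⟨hcard, -⟩ := card_support_mul_choose_le hsub ha hb
    have hch : m.choose d ≤ m.choose ab.1.totalDegree :=
      hmin _ (Finset.mem_Ioc.mpr ⟨hdeg.1, hdeg.2⟩)
    calc (ab.1 * ab.2).support.card * m.choose d
        ≤ (ab.1 * ab.2).support.card * m.choose ab.1.totalDegree := Nat.mul_le_mul_left _ hch
      _ ≤ m.factorial := hcard
  -- count: `|supp p| C(m,d) ≤ Σ |mon(a_i b_i)| C(m,d) ≤ |L| m!`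
  have hsupp : p.support.card ≤ (L.map fun ab => (ab.1 * ab.2).support.card).sum := by
    rw [hLsum]
    clear hLsum hLlen hLdeg hterm
    induction L with
    | nil => simp
    | cons ab L ih =>
      simp only [List.map_cons, List.sum_cons]
      exact (Finset.card_le_card support_add).trans ((Finset.card_union_le _ _).trans
        (Nat.add_le_add_left ih _))
  calc p.support.card * m.choose d
      ≤ (L.map fun ab => (ab.1 * ab.2).support.card).sum * m.choose d :=
        Nat.mul_le_mul_right _ hsupp
    _ = (L.map fun ab => (ab.1 * ab.2).support.card * m.choose d).sum := by
        rw [List.sum_map_mul_right]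
    _ ≤ (L.map fun _ => m.factorial).sum := List.sum_le_sum (fun ab hab => hterm ab hab)
    _ = L.length * m.factorial := by rw [List.map_const', List.sum_replicate, smul_eq_mul]
    _ ≤ prodCount P * m.factorial := Nat.mul_le_mul_right _ hLlen

/-! ### The stub -/

/-- **stub_sharpSubSupportCount — Jerrum–Snir by sub-support with the EXACT binomial.**  For
`m ≥ 3` and `supp p ⊆ supp per_m` there is a degree `d` in the window `m < 3d ≤ 2m` with
`#supp p · C(m,d) ≤ L⁺(p) · m!`: take `d ∈ Finset.Ioc (m/3) (2*(m/3))` (nonempty, it contains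
`m/3 + 1`) minimising `C(m, ·)` (`Finset.exists_min_image`) and a minimal fan-in-two circuit
(`exists_computes_size_eq_complexity`, `prodCount_le_size`), and apply
`card_support_mul_choose_le_prodCount_mul`; the window inequalities are `omega`.
[cite: JerrumSnir1982, §4.3 and Cor. 3.5] -/
theorem stub_sharpSubSupportCount :
    ∀ (m : ℕ), 3 ≤ m → ∀ (p : MvPolynomial (Fin m × Fin m) ℝ≥0),
      p.support ⊆ (perPoly (Fin m) ℝ≥0).support →
        ∃ d : ℕ, m < 3 * d ∧ 3 * d ≤ 2 * m ∧
          p.support.card * m.choose d ≤ complexity p * m.factorial := by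
  intro m hm p hp
  classical
  have hW : (Finset.Ioc (m / 3) (2 * (m / 3))).Nonempty :=
    ⟨m / 3 + 1, Finset.mem_Ioc.mpr ⟨by omega, by omega⟩⟩
  obtain ⟨d, hd, hmin⟩ :=
    Finset.exists_min_image (Finset.Ioc (m / 3) (2 * (m / 3))) (fun d => m.choose d) hW
  obtain ⟨hd1, hd2⟩ := Finset.mem_Ioc.mp hd
  obtain ⟨P, h2, hP, hsize⟩ := ArithCircuit.exists_computes_size_eq_complexity p
  refine ⟨d, by omega, by omega, ?_⟩
  rw [← hsize]
  exact (card_support_mul_choose_le_prodCount_mul hm hp h2 hP hmin).trans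
    (Nat.mul_le_mul_right _ (prodCount_le_size P))

end Summit.ValiantsHypothesis.ValiantsHypothesis.Theorems.DivisionGap.PerMultiplesHard.SharpSubSupportCount

end
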